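import Summits.BirchSwinnertonDyer.Rank1Residual.X6.RankZeroCertificateInertPairNamed
import HarnessLib

/-!
# Class X6 ∧ analytic rank `0` — the inert-pair certificate WITH THE UNIT CONJUNCT `p ∤ (ℓ₁² − 1)(ℓ₂² − 1)`,
# decided in the kernel for every record: 103 of the 113 records at `p ≥ 5` keep a pair; the 10 losers by name

Cell `bsd-print-x6` (D-0131 (2) print tier, key `x6`; HOME `run/shared/lean/pub/bsd-print-x6/`), typer seat ty3 (gen 6).
Sibling of `RankZeroCertificateInertPair.lean` (p561444: the Bool certificate `Record.inertPairAt` — two distinct listed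
multiplicative primes with `p ∤ ord_ℓ Δ_min` — its structural kernel theorems and the census 113/113 @ `p ≥ 5`) and of
`RankZeroCertificateInertPairNamed.lean` (p564740: the same under ty2's name `Supersingular.HasInertPair`, p561619).
PARTITION (D-0054): leaf X6 ∧ r = 0 (K3 row A6) — types-the-object-of; closes NONE. HONEST FRAMING: nothing here asserts BSD or
any `L`-value; every theorem is a statement about the reduction types and `ord_ℓ Δ_min` of an explicit minimal model and about
the residues `ℓ mod p` of its bad primes, PROVED from kernel-rechecked integer data.

WHY. The cell referee's R-5.2 (HOME/REFEREE.md §2, INBOX 2026-08-27T21:32:43Z) NARROWED the provenance flag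
`CW24-JSW17-LBDP-identification@HB15` of road (I) (the inert-pair quaternionic road for the Rest residual
`EisensteinHalfFiveLeRest`, stmt-BirchSwinnertonDyer-21116, `N⁻ = ℓ₁ℓ₂`) to the rider «`p ∣ (ℓ₁²−1)(ℓ₂²−1)` ∨ Pra06 §1»: the
interpolation constant `C(f,ψ)` of Jetchev–Skinner–Wan 2017 carries the factor `∏_{ℓ ∣ N⁻} (ℓ−1)/(ℓ+1)` (arXiv:1512.06894 p. 21,
the display after (5.1.1); read at the page), and for an odd prime `p` that factor is a `p`-adic unit iff `p ∤ (ℓ₁−1)(ℓ₁+1)(ℓ₂−1)(ℓ₂+1)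
= (ℓ₁²−1)(ℓ₂²−1)`. The referee's cheap repair α′ is the extra conjunct `¬ p ∣ (ℓ₁ ^ 2 - 1) * (ℓ₂ ^ 2 - 1)` on the pair predicate
(ty2's announced `Supersingular.HasInertPairPrimeToUnits`, INBOX 21:32:59Z — not yet in the tree; THIS file states the property
STRUCTURALLY, as p561444 did before `HasInertPair` landed: `HasInertPair`'s body with the unit conjunct appended LAST), and the
referee asked ty3 for the census column. This file decides it record by record:

* §0 arithmetic of the conjunct: for a prime `ℓ ≠ 3`, `3 ∣ ℓ² − 1`; hence at `p = 3` the conjunct fails for ANY two distinct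
  primes (`three_dvd_unitConj_of_prime_ne`) and the narrowed property is EMPTY at `p = 3` for every curve
  (`not_exists_inertPairCoprime_at_three`) — consistent with road (I)'s printed inputs needing `p ≥ 5`.
* §1 the Bool certificate `Record.inertPairCoprimeAt` (two listed bad pairs `(q₁,v₁) ≠ (q₂,v₂)` by prime with `p ∤ v₁`, `p ∤ v₂`,
  `p ∤ (q₁²−1)(q₂²−1)`), the kernel theorems `Record.exists_inertPairCoprime_of_check` / `Record.not_exists_inertPairCoprime_of_check`
  (certificate `false` ⇒ NO such pair: a multiplicative prime is bad, hence listed with `ord_ℓ Δ_min` the listed exponent), the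
  refinement `inertPairAt_of_inertPairCoprimeAt` and the projection onto `HasInertPair`.
* §2 the census (kernel recount = HOME/ty3 python `calc/census2.py` over the record files): at `p ≥ 5`, **103 of the 113 records
  keep a pair with the unit conjunct** — Err 99 of 107, Rest 4 of 6 — and the **10 losers are all at `p = 5`** (76/86 keep @ 5;
  27/27 keep @ `p ∈ {7, 11, 13}`): Err `45298c1, 75966b1, 78483c1, 120974c1, 157263e1, 266113a1, 280343c1, 495403b1` (each carries
  an erratum prime — road (E)) and Rest `246697a1, 321518d1` (the referee's two sampled losers; both booked per pair); each loser has
  exactly ONE listed prime with `5 ∤ v` and `q ≢ ±1 (mod 5)`. Number of usable primes (`p ∤ v ∧ p ∤ q²−1`) per record at `p ≥ 5`: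
  1 on 10 (= the losers), 2 on 38, 3 on 46, 4 on 11, 5 on 7, 6 on 1. At `p = 3`: 0 of 621 (§0).
* §3 adapters in the cell files' `hWeq` shape (`exists_inertPairCoprime_of_exists` / `not_exists_inertPairCoprime_of_exists`) and the
  six Rest cells at `p ≥ 5` by name: keepers `138594b1 @ 5` (pair `(2,3)`), `331554a1 @ 5` (`(2,3)`), `12927e1 @ 7` (`(3,31)`;
  `139 ≡ −1 (7)` is NOT usable), `399190l1 @ 7` (`2, 5, 11, 191` usable), the T3 witness Err cell `22678e1 @ 5` (`(17,23)`;
  `29 ≡ −1 (5)` not usable), and the two Rest LOSERS `246697a1 @ 5` (bad `11, 41, 547`: `11 ≡ 1`, `41 ≡ 1 (5)`; only `547` usable),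
  `321518d1 @ 5` (bad `2, 19, 8461`: `19 ≡ −1`, `8461 ≡ 1 (5)`; only `2` usable) as kernel NEGATIVES.

Data (Cremona / PARI two engines = records14–16). beyond-print theorem: NO.
References: J. H. Silverman, *AEC* (2009) VII.5 Prop. 5.1 [SilvermanAEC2009]; D. Jetchev, C. Skinner, X. Wan, *The Birch and
Swinnerton-Dyer formula for elliptic curves of analytic rank one*, Camb. J. Math. 5 (2017), arXiv:1512.06894 p. 21 (the constant
`C(f,ψ)`; shape only, nothing asserted) [JetchevSkinnerWan2017]; Castella–Wan 2024 Thm 5.3 / Prop. 2.1 (shape only) [CastellaWan2023];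
Cremona's tables [Cremona2006]; HOME/REFEREE.md R-5.2, HOME/DOSSIER.md A20.
-/

set_option autoImplicit false

open WeierstrassCurve Literature.NumberTheory.EllipticCurves
  Literature.NumberTheory.EllipticCurves.Rank1Residual
open Summit.BirchSwinnertonDyer.Rank1Residual.Supersingular (HasInertPair)

namespace Summit.BirchSwinnertonDyer.Rank1Residual.X6.PrintCert

/-! ### §0 Arithmetic of the unit conjunct -/

/-- For a prime `ℓ ≠ 3`, `3 ∣ ℓ² − 1` (`ℓ ≡ ±1 (mod 3)`). [folklore] -/
theorem three_dvd_sq_sub_one_of_prime_ne {ℓ : ℕ} (hℓ : ℓ.Prime) (h3 : ℓ ≠ 3) : 3 ∣ ℓ ^ 2 - 1 := by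
  have hnd : ¬ 3 ∣ ℓ := fun h => h3 ((Nat.prime_dvd_prime_iff_eq Nat.prime_three hℓ).mp h).symm
  have hmod : ℓ % 3 = 1 ∨ ℓ % 3 = 2 := by omega
  apply Nat.dvd_of_mod_eq_zero
  apply Nat.sub_mod_eq_zero_of_mod_eq
  rw [Nat.pow_mod]
  rcases hmod with h | h <;> rw [h]

/-- **At `p = 3` the unit conjunct fails for any two DISTINCT primes**: one of them is `≠ 3`. [folklore] -/
theorem three_dvd_unitConj_of_prime_ne {ℓ₁ ℓ₂ : ℕ} (h₁ : ℓ₁.Prime) (h₂ : ℓ₂.Prime) (hne : ℓ₁ ≠ ℓ₂) :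
    3 ∣ (ℓ₁ ^ 2 - 1) * (ℓ₂ ^ 2 - 1) := by
  by_cases h3 : ℓ₁ = 3
  · subst h3
    exact Dvd.dvd.mul_left (three_dvd_sq_sub_one_of_prime_ne h₂ (Ne.symm hne)) _
  · exact Dvd.dvd.mul_right (three_dvd_sq_sub_one_of_prime_ne h₁ h3) _

/-- Hence the narrowed inert-pair property (inert pair + unit conjunct) is EMPTY at `p = 3` for every curve. [folklore] -/
theorem not_exists_inertPairCoprime_at_three (W : WeierstrassCurve ℚ) [W.IsGloballyMinimal] :
    ¬ ∃ ℓ₁ ℓ₂ : ℕ, ∃ _ : Fact ℓ₁.Prime, ∃ _ : Fact ℓ₂.Prime, ℓ₁ ≠ ℓ₂ ∧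
      W.HasMultiplicativeReductionAtPrime ℓ₁ ∧ W.HasMultiplicativeReductionAtPrime ℓ₂ ∧
      ¬ 3 ∣ padicValInt ℓ₁ W.minimalDiscriminantInt ∧ ¬ 3 ∣ padicValInt ℓ₂ W.minimalDiscriminantInt ∧
      ¬ 3 ∣ (ℓ₁ ^ 2 - 1) * (ℓ₂ ^ 2 - 1) := by
  rintro ⟨ℓ₁, ℓ₂, i₁, i₂, hne, -, -, -, -, hcop⟩
  exact hcop (three_dvd_unitConj_of_prime_ne i₁.out i₂.out hne)

/-! ### §1 The certificate and the kernel theorems -/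

namespace Record

variable (r : Record)

/-- **Inert-pair certificate with the unit conjunct** of a record: two listed bad pairs `(q₁, v₁)`, `(q₂, v₂)` with `q₁ ≠ q₂`,
`p ∤ v₁`, `p ∤ v₂` and `p ∤ (q₁² − 1)(q₂² − 1)` (on X6 every bad prime is multiplicative and `v = ord_q Δ_min`, so this is «two
distinct multiplicative primes with `E[p]` ramified at both and `q_i ≢ ±1 (mod p)`»). [folklore] -/
def inertPairCoprimeAt : Bool :=
  r.bad.any fun t₁ => r.bad.any fun t₂ =>
    decide (t₁.1 ≠ t₂.1) && decide (¬ r.p ∣ t₁.2) && decide (¬ r.p ∣ t₂.2) && decide (¬ r.p ∣ (t₁.1 ^ 2 - 1) * (t₂.1 ^ 2 - 1))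

/-- The new certificate REFINES the inert-pair certificate of p561444 (drop the unit conjunct). [folklore] -/
theorem inertPairAt_of_inertPairCoprimeAt (h : r.inertPairCoprimeAt = true) : r.inertPairAt = true := by
  obtain ⟨t₁, ht₁, h₁⟩ := List.any_eq_true.mp h
  obtain ⟨t₂, ht₂, h₂⟩ := List.any_eq_true.mp h₁
  simp only [Bool.and_eq_true, decide_eq_true_eq] at h₂
  obtain ⟨⟨⟨hne, hv₁⟩, hv₂⟩, -⟩ := h₂
  refine List.any_eq_true.mpr ⟨t₁, ht₁, List.any_eq_true.mpr ⟨t₂, ht₂, ?_⟩⟩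
  simp only [Bool.and_eq_true, decide_eq_true_eq]
  exact ⟨⟨hne, hv₁⟩, hv₂⟩

/-- **The narrowed inert-pair property for a certified record with the certificate** (kernel theorem, no claim): two distinct
primes of multiplicative reduction `ℓ₁ ≠ ℓ₂` of the record's curve with `p ∤ ord_{ℓ_i} Δ_min` and `p ∤ (ℓ₁² − 1)(ℓ₂² − 1)` —
`HasInertPair`'s body with the unit conjunct appended last, stated structurally. [cite: SilvermanAEC2009, VII.5 Prop. 5.1(b)] -/
theorem exists_inertPairCoprime_of_check (hc : r.check = true) [r.curve.IsElliptic] [r.curve.IsGloballyMinimal]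
    (h : r.inertPairCoprimeAt = true) :
    ∃ ℓ₁ ℓ₂ : ℕ, ∃ _ : Fact ℓ₁.Prime, ∃ _ : Fact ℓ₂.Prime, ℓ₁ ≠ ℓ₂ ∧
      r.curve.HasMultiplicativeReductionAtPrime ℓ₁ ∧ r.curve.HasMultiplicativeReductionAtPrime ℓ₂ ∧
      ¬ r.p ∣ padicValInt ℓ₁ r.curve.minimalDiscriminantInt ∧ ¬ r.p ∣ padicValInt ℓ₂ r.curve.minimalDiscriminantInt ∧
      ¬ r.p ∣ (ℓ₁ ^ 2 - 1) * (ℓ₂ ^ 2 - 1) := by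
  obtain ⟨t₁, ht₁, h₁⟩ := List.any_eq_true.mp h
  obtain ⟨t₂, ht₂, h₂⟩ := List.any_eq_true.mp h₁
  simp only [Bool.and_eq_true, decide_eq_true_eq] at h₂
  obtain ⟨⟨⟨hne, hv₁⟩, hv₂⟩, hcop⟩ := h₂
  obtain ⟨hm₁, hval₁⟩ := r.mult_and_val_of_mem_bad hc ht₁
  obtain ⟨hm₂, hval₂⟩ := r.mult_and_val_of_mem_bad hc ht₂
  exact ⟨t₁.1, t₂.1, _, _, hne, hm₁, hm₂, by rw [hval₁]; exact hv₁, by rw [hval₂]; exact hv₂, hcop⟩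

/-- **No narrowed inert pair for a certified record WITHOUT the certificate** (kernel theorem): two distinct multiplicative
primes with `p ∤ ord Δ_min` and the unit conjunct would both be bad, hence listed (`mem_badPrimes_of_not_good`) with `ord_ℓ Δ_min`
the listed exponent (`mult_and_val_of_mem_bad`), and the certificate would hold. [cite: SilvermanAEC2009, VII.5 Prop. 5.1(a) and (b)] -/
theorem not_exists_inertPairCoprime_of_check (hc : r.check = true) [r.curve.IsElliptic] [r.curve.IsGloballyMinimal]
    (h : r.inertPairCoprimeAt = false) :
    ¬ ∃ ℓ₁ ℓ₂ : ℕ, ∃ _ : Fact ℓ₁.Prime, ∃ _ : Fact ℓ₂.Prime, ℓ₁ ≠ ℓ₂ ∧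
      r.curve.HasMultiplicativeReductionAtPrime ℓ₁ ∧ r.curve.HasMultiplicativeReductionAtPrime ℓ₂ ∧
      ¬ r.p ∣ padicValInt ℓ₁ r.curve.minimalDiscriminantInt ∧ ¬ r.p ∣ padicValInt ℓ₂ r.curve.minimalDiscriminantInt ∧
      ¬ r.p ∣ (ℓ₁ ^ 2 - 1) * (ℓ₂ ^ 2 - 1) := by
  rintro ⟨ℓ₁, ℓ₂, hℓ₁, hℓ₂, hne, hm₁, hm₂, hv₁, hv₂, hcop⟩
  have hbad₁ : ¬ r.curve.HasGoodReductionAtPrime ℓ₁ :=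
    fun hgood => WeierstrassCurve.HasMultiplicativeReduction.not_hasGoodReduction (R := ℤ_[ℓ₁]) hm₁ hgood
  have hbad₂ : ¬ r.curve.HasGoodReductionAtPrime ℓ₂ :=
    fun hgood => WeierstrassCurve.HasMultiplicativeReduction.not_hasGoodReduction (R := ℤ_[ℓ₂]) hm₂ hgood
  obtain ⟨⟨q₁, v₁⟩, ht₁, hq₁⟩ := r.exists_mem_bad_of_mem_badPrimes (r.mem_badPrimes_of_not_good hc hℓ₁.out hbad₁)
  obtain ⟨⟨q₂, v₂⟩, ht₂, hq₂⟩ := r.exists_mem_bad_of_mem_badPrimes (r.mem_badPrimes_of_not_good hc hℓ₂.out hbad₂)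
  have e₁ : q₁ = ℓ₁ := hq₁
  have e₂ : q₂ = ℓ₂ := hq₂
  subst e₁ e₂
  have hw₁ := (r.mult_and_val_of_mem_bad hc ht₁).2
  have hw₂ := (r.mult_and_val_of_mem_bad hc ht₂).2
  dsimp only at hw₁ hw₂
  rw [hw₁] at hv₁
  rw [hw₂] at hv₂
  have htrue : r.inertPairCoprimeAt = true := by
    refine List.any_eq_true.mpr ⟨(q₁, v₁), ht₁, List.any_eq_true.mpr ⟨(q₂, v₂), ht₂, ?_⟩⟩
    simp only [Bool.and_eq_true, decide_eq_true_eq]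
    exact ⟨⟨⟨hne, hv₁⟩, hv₂⟩, hcop⟩
  rw [htrue] at h
  exact Bool.noConfusion h

/-- Projection onto ty2's `HasInertPair` (p561619): a certified record with the new certificate has an inert pair.
[cite: SilvermanAEC2009, VII.5 Prop. 5.1(b)] -/
theorem hasInertPair_of_inertPairCoprimeAt (hc : r.check = true) [r.curve.IsElliptic] [r.curve.IsGloballyMinimal]
    (h : r.inertPairCoprimeAt = true) : HasInertPair r.curve r.p :=
  r.hasInertPair_of_check hc (r.inertPairAt_of_inertPairCoprimeAt h)

end Record

/-! ### §2 The census (kernel recount) -/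

/-- **103 of the 113 records at `p ≥ 5` keep an inert pair with the unit conjunct** (Err 99 of 107, Rest 4 of 6; 10 losers:
8 Err, 2 Rest); at `p = 3` none does (§0). [folklore] -/
theorem inertPairCoprime_counts_allRecords :
    (allRecords.filter fun r => 5 ≤ r.p).length = 113 ∧
    (allRecords.filter fun r => 5 ≤ r.p ∧ r.inertPairCoprimeAt = true).length = 103 ∧
    (allRecords.filter fun r => 5 ≤ r.p ∧ r.inertPairCoprimeAt = false).length = 10 ∧
    (allRecords.filter fun r => 5 ≤ r.p ∧ r.errAt = true ∧ r.inertPairCoprimeAt = true).length = 99 ∧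
    (allRecords.filter fun r => 5 ≤ r.p ∧ r.errAt = true ∧ r.inertPairCoprimeAt = false).length = 8 ∧
    (allRecords.filter fun r => 5 ≤ r.p ∧ r.restAt = true ∧ r.inertPairCoprimeAt = true).length = 4 ∧
    (allRecords.filter fun r => 5 ≤ r.p ∧ r.restAt = true ∧ r.inertPairCoprimeAt = false).length = 2 ∧
    (allRecords.filter fun r => r.p = 3 ∧ r.inertPairCoprimeAt = true).length = 0 := by
  decide +kernel

/-- **The losers are all at `p = 5`**: 76 of the 86 records at `p = 5` keep a pair with the unit conjunct, and ALL 27 records at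
`p ∈ {7, 11, 13}` do. [folklore] -/
theorem inertPairCoprime_counts_by_prime :
    (allRecords.filter fun r => r.p = 5).length = 86 ∧
    (allRecords.filter fun r => r.p = 5 ∧ r.inertPairCoprimeAt = true).length = 76 ∧
    (allRecords.filter fun r => 7 ≤ r.p).length = 27 ∧
    (allRecords.filter fun r => 7 ≤ r.p ∧ r.inertPairCoprimeAt = true).length = 27 ∧
    (allRecords.all fun r => !decide (7 ≤ r.p) || r.inertPairCoprimeAt) = true := by
  decide +kernel

/-- **The 10 records at `p ≥ 5` WITHOUT an inert pair satisfying the unit conjunct**, as `(label, p, errAt)`: eight Err cells and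
the two Rest cells `246697a1`, `321518d1` (all at `p = 5`). [cite: Cremona2006, Table 1 (Cremona labels)] -/
theorem noInertPairCoprime_five_le_labels :
    ((allRecords.filter fun r => 5 ≤ r.p ∧ r.inertPairCoprimeAt = false).map fun r => (r.label, r.p, r.errAt)) =
    [("45298c1", 5, true), ("75966b1", 5, true), ("78483c1", 5, true), ("120974c1", 5, true), ("157263e1", 5, true),
      ("246697a1", 5, false), ("266113a1", 5, true), ("280343c1", 5, true), ("321518d1", 5, false), ("495403b1", 5, true)] := by
  decide +kernel

/-- The two Rest cells at `p ≥ 5` without a narrowed pair, by label. [cite: Cremona2006, Table 1 (Cremona labels)] -/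
theorem noInertPairCoprime_rest_labels :
    ((allRecords.filter fun r => 5 ≤ r.p ∧ r.restAt = true ∧ r.inertPairCoprimeAt = false).map Record.label) =
    ["246697a1", "321518d1"] := by
  decide +kernel

/-- Distribution at `p ≥ 5` of the number of USABLE listed bad primes (`p ∤ ord_q Δ_min` and `p ∤ q² − 1`): 1 on 10 records
(exactly the losers), 2 on 38, 3 on 46, 4 on 11, 5 on 7, 6 on 1. [folklore] -/
theorem usableCount_five_le :
    (((allRecords.filter fun r => 5 ≤ r.p).map fun r =>
        (r.bad.filter fun t => ¬ r.p ∣ t.2 ∧ ¬ r.p ∣ t.1 ^ 2 - 1).length).count 1 = 10) ∧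
    (((allRecords.filter fun r => 5 ≤ r.p).map fun r =>
        (r.bad.filter fun t => ¬ r.p ∣ t.2 ∧ ¬ r.p ∣ t.1 ^ 2 - 1).length).count 2 = 38) ∧
    (((allRecords.filter fun r => 5 ≤ r.p).map fun r =>
        (r.bad.filter fun t => ¬ r.p ∣ t.2 ∧ ¬ r.p ∣ t.1 ^ 2 - 1).length).count 3 = 46) ∧
    (((allRecords.filter fun r => 5 ≤ r.p).map fun r =>
        (r.bad.filter fun t => ¬ r.p ∣ t.2 ∧ ¬ r.p ∣ t.1 ^ 2 - 1).length).count 4 = 11) ∧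
    (((allRecords.filter fun r => 5 ≤ r.p).map fun r =>
        (r.bad.filter fun t => ¬ r.p ∣ t.2 ∧ ¬ r.p ∣ t.1 ^ 2 - 1).length).count 5 = 7) ∧
    (((allRecords.filter fun r => 5 ≤ r.p).map fun r =>
        (r.bad.filter fun t => ¬ r.p ∣ t.2 ∧ ¬ r.p ∣ t.1 ^ 2 - 1).length).count 6 = 1) ∧
    ((allRecords.filter fun r => 5 ≤ r.p ∧ (r.bad.filter fun t => ¬ r.p ∣ t.2 ∧ ¬ r.p ∣ t.1 ^ 2 - 1).length ≤ 1).map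
        Record.label) =
      ["45298c1", "75966b1", "78483c1", "120974c1", "157263e1", "246697a1", "266113a1", "280343c1", "321518d1", "495403b1"] := by
  decide +kernel

/-- **The narrowed property is DECIDED on the display**: for a listed record, «inert pair with the unit conjunct» `↔ inertPairCoprimeAt`.
[cite: SilvermanAEC2009, VII.5 Prop. 5.1(a) and (b)] -/
theorem exists_inertPairCoprime_iff_of_mem (r : Record) (hr : r ∈ allRecords) :
    haveI := (r.elliptic_and_minimal_of_check (check_of_mem_of_certified certified_allRecords hr)).1
    haveI := (r.elliptic_and_minimal_of_check (check_of_mem_of_certified certified_allRecords hr)).2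
    (∃ ℓ₁ ℓ₂ : ℕ, ∃ _ : Fact ℓ₁.Prime, ∃ _ : Fact ℓ₂.Prime, ℓ₁ ≠ ℓ₂ ∧
      r.curve.HasMultiplicativeReductionAtPrime ℓ₁ ∧ r.curve.HasMultiplicativeReductionAtPrime ℓ₂ ∧
      ¬ r.p ∣ padicValInt ℓ₁ r.curve.minimalDiscriminantInt ∧ ¬ r.p ∣ padicValInt ℓ₂ r.curve.minimalDiscriminantInt ∧
      ¬ r.p ∣ (ℓ₁ ^ 2 - 1) * (ℓ₂ ^ 2 - 1)) ↔ r.inertPairCoprimeAt = true := by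
  have hc := check_of_mem_of_certified certified_allRecords hr
  haveI := (r.elliptic_and_minimal_of_check hc).1
  haveI := (r.elliptic_and_minimal_of_check hc).2
  refine ⟨fun h => ?_, fun h => r.exists_inertPairCoprime_of_check hc h⟩
  by_contra hne
  exact r.not_exists_inertPairCoprime_of_check hc (Bool.eq_false_iff.mpr hne) h

/-- **Every listed record at `p ≥ 7` keeps an inert pair with the unit conjunct** (27/27). [cite: SilvermanAEC2009, VII.5 Prop. 5.1(b)] -/
theorem exists_inertPairCoprime_of_mem_seven_le (r : Record) (hr : r ∈ allRecords) (h7 : 7 ≤ r.p) :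
    haveI := (r.elliptic_and_minimal_of_check (check_of_mem_of_certified certified_allRecords hr)).1
    haveI := (r.elliptic_and_minimal_of_check (check_of_mem_of_certified certified_allRecords hr)).2
    ∃ ℓ₁ ℓ₂ : ℕ, ∃ _ : Fact ℓ₁.Prime, ∃ _ : Fact ℓ₂.Prime, ℓ₁ ≠ ℓ₂ ∧
      r.curve.HasMultiplicativeReductionAtPrime ℓ₁ ∧ r.curve.HasMultiplicativeReductionAtPrime ℓ₂ ∧
      ¬ r.p ∣ padicValInt ℓ₁ r.curve.minimalDiscriminantInt ∧ ¬ r.p ∣ padicValInt ℓ₂ r.curve.minimalDiscriminantInt ∧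
      ¬ r.p ∣ (ℓ₁ ^ 2 - 1) * (ℓ₂ ^ 2 - 1) := by
  have hc := check_of_mem_of_certified certified_allRecords hr
  haveI := (r.elliptic_and_minimal_of_check hc).1
  haveI := (r.elliptic_and_minimal_of_check hc).2
  have hx := List.all_eq_true.mp inertPairCoprime_counts_by_prime.2.2.2.2 r hr
  simp only [Bool.or_eq_true, Bool.not_eq_true', decide_eq_false_iff_not] at hx
  rcases hx with hlt | hcert
  · exact absurd h7 hlt
  · exact r.exists_inertPairCoprime_of_check hc hcert

/-! ### §3 `hWeq` adapters, the six Rest cells at `p ≥ 5` and the T3 witness cell -/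

section Adapters

variable {rs : List Record} {W : WeierstrassCurve ℚ} [W.IsElliptic] [W.IsGloballyMinimal] {a1 a2 a3 a4 a6 : ℤ}

/-- **The narrowed inert-pair property in the `hWeq` shape** from a certified list containing a record with these a-invariants,
this `p` and the certificate. [cite: SilvermanAEC2009, VII.5 Prop. 5.1(b)] -/
theorem exists_inertPairCoprime_of_exists (hrs : certified rs = true) {p : ℕ}
    (h : ∃ r ∈ rs, r.ainvs = [a1, a2, a3, a4, a6] ∧ r.p = p ∧ r.inertPairCoprimeAt = true)
    (hWeq : W = ⟨a1, a2, a3, a4, a6⟩) :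
    ∃ ℓ₁ ℓ₂ : ℕ, ∃ _ : Fact ℓ₁.Prime, ∃ _ : Fact ℓ₂.Prime, ℓ₁ ≠ ℓ₂ ∧
      W.HasMultiplicativeReductionAtPrime ℓ₁ ∧ W.HasMultiplicativeReductionAtPrime ℓ₂ ∧
      ¬ p ∣ padicValInt ℓ₁ W.minimalDiscriminantInt ∧ ¬ p ∣ padicValInt ℓ₂ W.minimalDiscriminantInt ∧
      ¬ p ∣ (ℓ₁ ^ 2 - 1) * (ℓ₂ ^ 2 - 1) := by
  obtain ⟨r, hr, hA, hp, hcert⟩ := h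
  have hc := check_of_mem_of_certified hrs hr
  have hW : W = r.curve := by rw [hWeq]; exact r.curve_eq hA
  subst hW
  subst hp
  exact r.exists_inertPairCoprime_of_check hc hcert

/-- **NO narrowed inert pair in the `hWeq` shape** from a certified list containing a record with these a-invariants, this `p` and
certificate `false`. [cite: SilvermanAEC2009, VII.5 Prop. 5.1(a) and (b)] -/
theorem not_exists_inertPairCoprime_of_exists (hrs : certified rs = true) {p : ℕ}
    (h : ∃ r ∈ rs, r.ainvs = [a1, a2, a3, a4, a6] ∧ r.p = p ∧ r.inertPairCoprimeAt = false)
    (hWeq : W = ⟨a1, a2, a3, a4, a6⟩) :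
    ¬ ∃ ℓ₁ ℓ₂ : ℕ, ∃ _ : Fact ℓ₁.Prime, ∃ _ : Fact ℓ₂.Prime, ℓ₁ ≠ ℓ₂ ∧
      W.HasMultiplicativeReductionAtPrime ℓ₁ ∧ W.HasMultiplicativeReductionAtPrime ℓ₂ ∧
      ¬ p ∣ padicValInt ℓ₁ W.minimalDiscriminantInt ∧ ¬ p ∣ padicValInt ℓ₂ W.minimalDiscriminantInt ∧
      ¬ p ∣ (ℓ₁ ^ 2 - 1) * (ℓ₂ ^ 2 - 1) := by
  obtain ⟨r, hr, hA, hp, hcert⟩ := h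
  have hc := check_of_mem_of_certified hrs hr
  have hW : W = r.curve := by rw [hWeq]; exact r.curve_eq hA
  subst hW
  subst hp
  exact r.not_exists_inertPairCoprime_of_check hc hcert

end Adapters

section RestCells

variable {W : WeierstrassCurve ℚ} [W.IsElliptic] [W.IsGloballyMinimal]

/-- `138594b1 @ 5` (Rest): bad `(2,2), (3,1), (23099,1)`; `2 ≡ 2`, `3 ≡ 3 (5)` — KEEPS a narrowed pair (e.g. `(2,3)`).
[cite: Cremona2006, Table 1 (Cremona label 138594b1)] -/
theorem inertPairCoprime_cell_138594b1_at5 (hWeq : W = ⟨1, 0, 0, -1443, -21219⟩) :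
    ∃ ℓ₁ ℓ₂ : ℕ, ∃ _ : Fact ℓ₁.Prime, ∃ _ : Fact ℓ₂.Prime, ℓ₁ ≠ ℓ₂ ∧
      W.HasMultiplicativeReductionAtPrime ℓ₁ ∧ W.HasMultiplicativeReductionAtPrime ℓ₂ ∧
      ¬ 5 ∣ padicValInt ℓ₁ W.minimalDiscriminantInt ∧ ¬ 5 ∣ padicValInt ℓ₂ W.minimalDiscriminantInt ∧
      ¬ 5 ∣ (ℓ₁ ^ 2 - 1) * (ℓ₂ ^ 2 - 1) :=
  exists_inertPairCoprime_of_exists certified_records14 (by decide +kernel) hWeq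

/-- `331554a1 @ 5` (Rest): bad `(2,2), (3,1), (55259,1)` — KEEPS a narrowed pair (e.g. `(2,3)`).
[cite: Cremona2006, Table 1 (Cremona label 331554a1)] -/
theorem inertPairCoprime_cell_331554a1_at5 (hWeq : W = ⟨1, 0, 0, -3453, -78387⟩) :
    ∃ ℓ₁ ℓ₂ : ℕ, ∃ _ : Fact ℓ₁.Prime, ∃ _ : Fact ℓ₂.Prime, ℓ₁ ≠ ℓ₂ ∧
      W.HasMultiplicativeReductionAtPrime ℓ₁ ∧ W.HasMultiplicativeReductionAtPrime ℓ₂ ∧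
      ¬ 5 ∣ padicValInt ℓ₁ W.minimalDiscriminantInt ∧ ¬ 5 ∣ padicValInt ℓ₂ W.minimalDiscriminantInt ∧
      ¬ 5 ∣ (ℓ₁ ^ 2 - 1) * (ℓ₂ ^ 2 - 1) :=
  exists_inertPairCoprime_of_exists certified_records15 (by decide +kernel) hWeq

/-- `12927e1 @ 7` (Rest): bad `(3,1), (31,2), (139,1)`; `139 ≡ −1 (7)` is NOT usable, `(3, 31)` is — KEEPS a narrowed pair.
[cite: Cremona2006, Table 1 (Cremona label 12927e1)] -/
theorem inertPairCoprime_cell_12927e1_at7 (hWeq : W = ⟨1, 0, 0, -42189461, -105479619702⟩) :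
    ∃ ℓ₁ ℓ₂ : ℕ, ∃ _ : Fact ℓ₁.Prime, ∃ _ : Fact ℓ₂.Prime, ℓ₁ ≠ ℓ₂ ∧
      W.HasMultiplicativeReductionAtPrime ℓ₁ ∧ W.HasMultiplicativeReductionAtPrime ℓ₂ ∧
      ¬ 7 ∣ padicValInt ℓ₁ W.minimalDiscriminantInt ∧ ¬ 7 ∣ padicValInt ℓ₂ W.minimalDiscriminantInt ∧
      ¬ 7 ∣ (ℓ₁ ^ 2 - 1) * (ℓ₂ ^ 2 - 1) :=
  exists_inertPairCoprime_of_exists certified_records16 (by decide +kernel) hWeq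

/-- `399190l1 @ 7` (Rest): bad `(2,1), (5,1), (11,1), (19,21), (191,2)`; usable `2, 5, 11, 191` (`19`: `7 ∣ 21`) — KEEPS a narrowed
pair. [cite: Cremona2006, Table 1 (Cremona label 399190l1)] -/
theorem inertPairCoprime_cell_399190l1_at7 (hWeq : W = ⟨1, -1, 1, -8615202972, -2594053676135591⟩) :
    ∃ ℓ₁ ℓ₂ : ℕ, ∃ _ : Fact ℓ₁.Prime, ∃ _ : Fact ℓ₂.Prime, ℓ₁ ≠ ℓ₂ ∧
      W.HasMultiplicativeReductionAtPrime ℓ₁ ∧ W.HasMultiplicativeReductionAtPrime ℓ₂ ∧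
      ¬ 7 ∣ padicValInt ℓ₁ W.minimalDiscriminantInt ∧ ¬ 7 ∣ padicValInt ℓ₂ W.minimalDiscriminantInt ∧
      ¬ 7 ∣ (ℓ₁ ^ 2 - 1) * (ℓ₂ ^ 2 - 1) :=
  exists_inertPairCoprime_of_exists certified_records16 (by decide +kernel) hWeq

/-- The route's T3 witness cell `22678e1 @ 5` (Err): bad `(2,75), (17,1), (23,1), (29,4)`; usable `17, 23` (`2`: `5 ∣ 75`;
`29 ≡ −1 (5)`) — KEEPS a narrowed pair. [cite: Cremona2006, Table 1 (Cremona label 22678e1)] -/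
theorem inertPairCoprime_cell_22678e1_at5 (hWeq : W = ⟨1, 0, 0, 3140254662, -139987982322460⟩) :
    ∃ ℓ₁ ℓ₂ : ℕ, ∃ _ : Fact ℓ₁.Prime, ∃ _ : Fact ℓ₂.Prime, ℓ₁ ≠ ℓ₂ ∧
      W.HasMultiplicativeReductionAtPrime ℓ₁ ∧ W.HasMultiplicativeReductionAtPrime ℓ₂ ∧
      ¬ 5 ∣ padicValInt ℓ₁ W.minimalDiscriminantInt ∧ ¬ 5 ∣ padicValInt ℓ₂ W.minimalDiscriminantInt ∧
      ¬ 5 ∣ (ℓ₁ ^ 2 - 1) * (ℓ₂ ^ 2 - 1) :=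
  exists_inertPairCoprime_of_exists certified_records14 (by decide +kernel) hWeq

/-- **LOSER `246697a1 @ 5` (Rest)**: bad `(11,6), (41,1), (547,1)`; `11 ≡ 1`, `41 ≡ 1 (5)` — only `547` is usable, so the curve has
NO inert pair with the unit conjunct at `5` (kernel negative; the cell is booked per pair). [cite: Cremona2006, Table 1 (Cremona label 246697a1)] -/
theorem noInertPairCoprime_cell_246697a1_at5 (hWeq : W = ⟨0, 0, 1, -292934695, -1929764585205⟩) :
    ¬ ∃ ℓ₁ ℓ₂ : ℕ, ∃ _ : Fact ℓ₁.Prime, ∃ _ : Fact ℓ₂.Prime, ℓ₁ ≠ ℓ₂ ∧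
      W.HasMultiplicativeReductionAtPrime ℓ₁ ∧ W.HasMultiplicativeReductionAtPrime ℓ₂ ∧
      ¬ 5 ∣ padicValInt ℓ₁ W.minimalDiscriminantInt ∧ ¬ 5 ∣ padicValInt ℓ₂ W.minimalDiscriminantInt ∧
      ¬ 5 ∣ (ℓ₁ ^ 2 - 1) * (ℓ₂ ^ 2 - 1) :=
  not_exists_inertPairCoprime_of_exists certified_records14 (by decide +kernel) hWeq

/-- **LOSER `321518d1 @ 5` (Rest)**: bad `(2,3), (19,2), (8461,3)`; `19 ≡ −1`, `8461 ≡ 1 (5)` — only `2` is usable, so the curve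
has NO inert pair with the unit conjunct at `5` (kernel negative; the cell is booked per pair). [cite: Cremona2006, Table 1 (Cremona label 321518d1)] -/
theorem noInertPairCoprime_cell_321518d1_at5 (hWeq : W = ⟨1, 0, 0, -80858, -9082420⟩) :
    ¬ ∃ ℓ₁ ℓ₂ : ℕ, ∃ _ : Fact ℓ₁.Prime, ∃ _ : Fact ℓ₂.Prime, ℓ₁ ≠ ℓ₂ ∧
      W.HasMultiplicativeReductionAtPrime ℓ₁ ∧ W.HasMultiplicativeReductionAtPrime ℓ₂ ∧
      ¬ 5 ∣ padicValInt ℓ₁ W.minimalDiscriminantInt ∧ ¬ 5 ∣ padicValInt ℓ₂ W.minimalDiscriminantInt ∧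
      ¬ 5 ∣ (ℓ₁ ^ 2 - 1) * (ℓ₂ ^ 2 - 1) :=
  not_exists_inertPairCoprime_of_exists certified_records15 (by decide +kernel) hWeq

end RestCells

end Summit.BirchSwinnertonDyer.Rank1Residual.X6.PrintCert
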